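import Summits.QuantumFields.YangMills.Theorems.BalabanUVNodesN15KingModelGraphPowerCountingRelabel

/-!
# BalabanUVNodes ∕ N15 — THE KING-MODEL RUNG (PART Γ-h): PROPOSITION 3.6's POWER COUNTING FOR GENERAL GRAPHS, BY NAME AT `A = 0`, WITH ONE ELIMINATION ORDER
# PER ORDERING — the size half, the `S^c` terms and the replacement majorants of parts Γ-c∕Γ-e re-run on part Γ-g's relabelled certificates `ForestCertR`
# (Track A, DAG node N15 = NE2; FAN-OUT v1.1 §N15 s3 «KING-MODEL RUNG … NE2's analogue DECIDED in the model»)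

HONEST FRAMING.  Count-neutral (cell `pub-ymgap`, seat `pub-ymgap-dag-n15-e` g27; `--supports stmt-QuantumFields-27366 --as helper` = K3⁸
`SpineGivenEndpointR13SepCoPHV`).  TEMPLATE LITERATURE: C. King, *The U(1) Higgs model. I. The continuum limit*, Commun. Math. Phys. **102** (1986) 649–677
[King1986], proof of Proposition 3.6, pp. 663–665.  The three King-side members of parts Γ-c (`king_graph_size_uniform_zeroField`) and Γ-e
(`king_graph_finest_small`, `sum_graphValLS_profileAt_le`) with the certificates allowed to RENUMBER the vertices per ordering (part Γ-g: King's shrinking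
order depends on the ordering; for graphs with cycles no single numbering serves all orderings).  Same proofs, part Γ-g's `…_R` assemblies in place of parts
Γ-b∕Γ-d's.  King's U(1)∕`A = 0` MODEL; NOT Bałaban's non-abelian `G(U)` of [B9]; NOT a node discharge; nothing continuum ∕ ℝ⁴ ∕ OS ∕ mass-gap ∕ Clay.
0 `sorry`; standard axioms.
THE PRINT.  p. 664 [PDF 16]: *«We get an upper bound for this expression by replacing every propagator by the bounds given in Proposition 3.7 … We then sum
over y, giving (3.68) … Graphically, we have shrunk l(1) to a point in H … Consider first a term … with S^c non-empty … and (3.70) gives L^{−γk}»*; p. 665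
[PDF 17]: *«the error is the same graph with a difference of propagators on one line. Redoing the analysis … the bound proceeds as before»*.
WHAT THIS FILE PROVES (namespace `…N15KingModelRung.Curved`; `cert : Perm (Fin m) → ForestCertR nn src tgt`, lists `orderList … π (cert π).F`).
* §1 ★★★ `king_graph_size_uniform_zeroField_R` — UV-finiteness of general graphs with King's full `A = 0` propagators on the lines, uniformly in `k`, under
  `PosDegrees` along every ordering (part Γ-c's theorem with relabelled certificates).
* §2 ★★ `king_graph_finest_small_R` — the `S^c` terms `≤ L^{−γ(K+1)}·…` (part Γ-e's, relabelled).
* §3 ★★ `sum_graphValLS_profileAt_le_R` — the profile majorant graphs summed over all assignments (part Γ-e's, relabelled).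
HONEST SCOPE.  As parts Γ-c∕Γ-e: positivity of the degrees along every ordering is a HYPOTHESIS (§3.5 ∕ Thm 3.5 NOT typed); certificates (now with a
renumbering) are user data — for a connected graph and an ordering `π`, Kruskal's tree of `π` with the vertices renumbered in breadth-first order from the
root is such a certificate and its order list has King's partial degrees `D(H_i)` (3.66) (construction not typed); `G`∕`∂G` lines; King's model; NOT Bałaban's
`G(U)`.  Locators: [King1986] (3.58)–(3.61) p.663, (3.66) p.663 (foot), (3.67)–(3.70) p.664, p.665, Prop. 3.7 (3.63) p.663.
-/
noncomputable section

namespace Summit.QuantumFields.YangMills.BalabanUVNodes.N15KingModelRung.Curved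

open scoped BigOperators
open Finset
open Literature.MathematicalPhysics.QuantumFieldTheory.Balaban1983to89.B5Prop11Plancherel (Tor fine unitVec)
open Literature.MathematicalPhysics.QuantumFieldTheory.King1986.Torus (tdistT tdistT_nonneg tdistT_symm)
open Literature.MathematicalPhysics.QuantumFieldTheory.King1986.SlicePropagator (SliceKernels TwoSpacing Prop37PrintedAt Prop39PrintedAt)
open Literature.MathematicalPhysics.QuantumFieldTheory.King1986.ContinuumLimit (eps)
open Summit.QuantumFields.YangMills.BalabanUVNodes.N15KingModelRung (KingVolIndex kingVol kingVol_neZero)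
open Summit.QuantumFields.YangMills.BalabanUVNodes.N15KingModelRung.Graph

variable {d : ℕ} (L : ℕ) [NeZero L]

/-! ## §1 The size half with one renumbering per ordering -/

section SizeR

/-- ★★★ **THE SIZE OF A GENERAL GRAPH WITH KING's FULL `A = 0` PROPAGATORS ON ITS LINES IS BOUNDED UNIFORMLY IN THE NUMBER OF SCALES — PROPOSITION
3.6's POWER COUNTING, SIZE HALF, BY NAME AT `A = 0`, WITH ONE ELIMINATION ORDER PER ORDERING (`ForestCertR`; part Γ-c's theorem relabelled).**  For odd `L ≥ 3`, `a > 0`, `m₀² ≥ 0` there are `C₁, C₂ > 0` (Prop. 3.7's constant per line, (3.68)'s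
per vertex) such that for every `k ≥ 1`, cube `M = 2L^{e_M}`, mass `0 < m² ≤ m₀²`, every NUMBERED graph — vertices `0, …, n` (external vertex `0`), internal
lines `0, …, m−1` with endpoints `src`, `tgt` and kinds `κ` (the line `ℓ` carries `G^η_k` or `∂^η_μG^η_k`, King's full `A = 0` propagator (2.13)),
one-vertex factors `u_υ` at `vtx υ` with sizes `|u_υ| ≤ q_υ` and a root-placed factor `υ₀` with `Σ_x η^{d+1}|u_{υ₀}(x)| ≤ Γ` (King's `|□′|`) — and every
family of spanning-forest certificates `cert π`, one per ordering `π` of the lines, whose exponent lists (loop line: `lineExp κ` = `2 − (d+1)` ∕ `1 − (d+1)`;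
tree line: `lineExp κ + (d+1)` = `lineDeg κ`) have POSITIVE PARTIAL DEGREES (King's «every subgraph `H_i` has positive degree», here a hypothesis):
`|E^{(k)}(H)| ≤ Γ·C₁^m·C₂^n·(Σ_π Π_i (1 − L^{−D_i(π)})^{−1})·Π_{υ ≠ υ₀} q_υ`, where `E^{(k)}(H) = graphValLS η^{d+1} src tgt (kingGLine … k ∘ κ) vtx u`.
ASSEMBLY: (2.17) multiplied out (§2) ⇒ `|E| ≤ Σ_j 𝔼(H(j))` ⇒ part Γ-b `sum_graphValLS_slices_le` with Prop. 3.7 by name (part Ρ `prop37PrintedAt_king_zeroField` at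
`α = ½`): sups by `abs_sliceLine_le_sup`, vertex sums by part Ι-c `lineSum_sliceLine_le` ∕ §1 `lineSum_sliceLine_le_col`.
[cite: King1986, Prop. 3.6 (3.56) p.662, (2.17) p.653, (3.58)–(3.59) p.663, Prop. 3.7 (3.63) p.663, (3.66)–(3.70) p.664] -/
theorem king_graph_size_uniform_zeroField_R (hLodd : Odd L) (hL : 2 ≤ L) {a : ℝ} (ha : 0 < a) {m0sq : ℝ} (hm0 : 0 ≤ m0sq) :
    ∃ C₁ C₂ : ℝ, 0 < C₁ ∧ 0 < C₂ ∧ ∀ (k eM : ℕ) (hk : 1 ≤ k) (M : Fin (d + 1) → ℕ) [∀ μ, NeZero (M μ)] (hM : ∀ μ, M μ = 2 * L ^ eM)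
      (msq : ℝ), 0 < msq → msq ≤ m0sq →
      ∀ (n m : ℕ) (src tgt : Fin m → Fin (n + 1)) (κ : Fin m → Option (Fin (d + 1)))
        (Υ : Type) [Fintype Υ] [DecidableEq Υ] (vtx : Υ → Fin (n + 1)) (u : Υ → Tor (fine (L ^ k) M) → ℝ) (q : Υ → ℝ) (υ₀ : Υ) (Γ : ℝ),
        vtx υ₀ = 0 → (∀ υ, υ ≠ υ₀ → ∀ x, |u υ x| ≤ q υ) → (∑ x, (((L : ℝ) ^ k)⁻¹) ^ (d + 1) * |u υ₀ x| ≤ Γ) →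
        ∀ cert : Equiv.Perm (Fin m) → ForestCertR n src tgt,
          (∀ π, PosDegrees (orderList ((d + 1 : ℕ) : ℝ) (fun ℓ => lineExp (d + 1) (κ ℓ)) π (cert π).F)) →
          |graphValLS ((((L : ℝ) ^ k)⁻¹) ^ (d + 1)) src tgt (fun ℓ => kingGLine L M a msq k (κ ℓ)) vtx u|
            ≤ Γ * (C₁ ^ m * C₂ ^ n
                * (∑ π : Equiv.Perm (Fin m), degConst L (orderList ((d + 1 : ℕ) : ℝ) (fun ℓ => lineExp (d + 1) (κ ℓ)) π (cert π).F))
                * ∏ υ ∈ univ.erase υ₀, q υ) := by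
  obtain ⟨C, δ₀, hC, hδ₀, H⟩ := prop37PrintedAt_king_zeroField (d := d) L hLodd hL ha hm0 (α := 1 / 2) (by norm_num) (by norm_num)
  refine ⟨C, c368 d δ₀, hC, c368_pos d hδ₀,
    fun k eM hk M _ hM msq hm hcap n m src tgt κ Υ _ _ vtx u q υ₀ Γ hυ₀ hq hΓ cert hpos => ?_⟩
  have h37 := H k eM hk M hM msq hm hcap
  have hL1 : 1 ≤ L := by omega
  have hw0 : (0 : ℝ) ≤ (((L : ℝ) ^ k)⁻¹) ^ (d + 1) := by positivity
  haveI : Nonempty (Tor (fine (L ^ k) M)) := ⟨fun _ => 0⟩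
  -- (2.17) multiplied out, the majorant graph of each `H(j)`
  rw [graphValLS_kingGLine_eq_sum L hL ha hk M hM hm _ src tgt κ vtx u]
  refine (Finset.abs_sum_le_sum_abs _ _).trans ?_
  refine (sum_le_sum fun j _ => abs_graphValLS_le _ src tgt _ vtx u).trans ?_
  rw [abs_of_nonneg hw0]
  -- part Γ-b with Prop. 3.7 by name
  exact sum_graphValLS_slices_le_R L hL hk vtx hw0
    (fun ℓ (c : Fin k) (x y : Tor (fine (L ^ k) M)) => |sliceLine (kingSliceKernels L k eM M hM hk a msq) (c : ℕ) (κ ℓ) x y|)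
    (fun ℓ c x y => abs_nonneg _) hC.le (c368_pos d hδ₀).le (((d + 1 : ℕ) : ℝ)) (fun ℓ => lineExp (d + 1) (κ ℓ))
    (fun ℓ c x y => abs_sliceLine_le_sup L hk M hM hC.le hδ₀.le h37 (by have := c.isLt; omega) (κ ℓ) x y)
    (fun ℓ c y => lineSum_sliceLine_le_row L hL1 hk M hM hC.le hδ₀ h37 (by have := c.isLt; omega) (κ ℓ) y)
    (fun ℓ c y => lineSum_sliceLine_le_col L hL1 hk M hM hC.le hδ₀ h37 (by have := c.isLt; omega) (κ ℓ) y)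
    (fun υ x => |u υ x|) (fun υ x => abs_nonneg _) υ₀ hυ₀ hΓ q hq cert hpos

end SizeR

/-! ## §2 The `S^c` terms with one renumbering per ordering -/

section PartAR

/-- ★★ **«(3.70) GIVES L^{−γk}» FOR GENERAL GRAPHS AT `A = 0`, RELABELLED CERTIFICATES** (part Γ-e's, on `ForestCertR`): for the `(K+n)`-run's graph values `E^{(K+n)}(H(j′))` (lines carrying the slices `G^{η′}_{(j′_ℓ)}`,
`∂^{η′}_μG^{η′}_{(j′_ℓ)}` of King's `A = 0` propagator on `T_{η′}`, `0 ≤ j′_ℓ < K + n`), the sum over the assignments with SOME line finer than the coarse spacing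
(`j′_ℓ < n`, King's `S^c ≠ ∅`) of `|E^{(K+n)}(H(j′))|` is at most `L^{−γ(K+1)}·Γ·C₁^m·C₂^{#vertices−1}·(Σ_π degConst(finest-lowered list))·Π q` — Prop. 3.7 of
the `(K+n)`-run by name for the sups and the vertex sums (part Γ-c §1), the generic `S^c` lemma (part Γ-d `sum_graphValLS_slices_lt_le`) and
`(L^{n−1}η′)^γ = L^{−γ(K+1)}`. [cite: King1986, (3.60)–(3.61) p.663, (3.70) p.664 («Consider first a term … with S^c non-empty … and (3.70) gives L^{−γk}»)] -/
theorem king_graph_finest_small_R (hL : 2 ≤ L) {a msq : ℝ} {K n eM : ℕ} (hK : 1 ≤ K) (hn : 1 ≤ n) (M : Fin (d + 1) → ℕ) [∀ μ, NeZero (M μ)]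
    (hM : ∀ μ, M μ = 2 * L ^ eM) {α C δ₀ C₁ C₂ : ℝ} (hC : 0 ≤ C) (hδ₀ : 0 < δ₀) (hC₁ : C ≤ C₁) (hC₂ : c368 d δ₀ ≤ C₂)
    (h37' : Prop37PrintedAt α (kingSliceKernels L (K + n) eM M hM (one_le_add_of_one_le hK n) a msq) C δ₀)
    {nn m : ℕ} (src tgt : Fin m → Fin (nn + 1)) (κ : Fin m → Option (Fin (d + 1))) {Υ : Type*} [Fintype Υ] [DecidableEq Υ]
    (vtx : Υ → Fin (nn + 1)) (u' : Υ → Tor (fine (L ^ (K + n)) M) → ℝ) (qq : Υ → ℝ) (υ₀ : Υ) (hυ₀ : vtx υ₀ = 0)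
    (hu' : ∀ υ, υ ≠ υ₀ → ∀ x', |u' υ x'| ≤ qq υ) {Γ : ℝ} (hΓ : ∑ x', (((L : ℝ) ^ (K + n))⁻¹) ^ (d + 1) * |u' υ₀ x'| ≤ Γ)
    (cert : Equiv.Perm (Fin m) → ForestCertR nn src tgt) {γ : ℝ} (hγ : 0 ≤ γ)
    (hpos : ∀ π, PosDegrees (List.ofFn fun p : Fin m =>
      lowerFinest γ (orderExps ((d + 1 : ℕ) : ℝ) (fun ℓ => lineExp (d + 1) (κ ℓ)) π (cert π).F) (Fin.rev p))) :
    ∑ j' : Fin m → Fin (K + n), (if ∃ ℓ, ((j' ℓ : ℕ)) < n then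
        |graphValLS ((((L : ℝ) ^ (K + n))⁻¹) ^ (d + 1)) src tgt
          (fun ℓ (x' y' : Tor (fine (L ^ (K + n)) M)) =>
            sliceLine (kingSliceKernels L (K + n) eM M hM (one_le_add_of_one_le hK n) a msq) (j' ℓ) (κ ℓ) x' y') vtx u'| else 0)
      ≤ (L : ℝ) ^ (-(γ * (K + 1 : ℕ))) * (Γ * (C₁ ^ m * C₂ ^ nn
          * (∑ π : Equiv.Perm (Fin m), degConst L (List.ofFn fun p : Fin m =>
              lowerFinest γ (orderExps ((d + 1 : ℕ) : ℝ) (fun ℓ => lineExp (d + 1) (κ ℓ)) π (cert π).F) (Fin.rev p)))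
          * ∏ υ ∈ univ.erase υ₀, qq υ)) := by
  have hL1 : 1 ≤ L := by omega
  have hL0 : (0 : ℝ) < L := by exact_mod_cast (show 0 < L by omega)
  have hw0 : (0 : ℝ) ≤ (((L : ℝ) ^ (K + n))⁻¹) ^ (d + 1) := by positivity
  haveI : Nonempty (Tor (fine (L ^ (K + n)) M)) := ⟨fun _ => 0⟩
  have hC₁0 : 0 ≤ C₁ := hC.trans hC₁
  have hC₂0 : 0 ≤ C₂ := (c368_pos d hδ₀).le.trans hC₂
  have hs0 : ∀ (c : Fin (K + n)) (ex : ℝ), 0 ≤ ((L : ℝ) ^ ((c : ℕ)) * eps L (K + n)) ^ ex := fun c ex =>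
    Real.rpow_nonneg (by unfold eps; positivity) _
  -- the finest factor
  have hθ : ((L : ℝ) ^ (n - 1) * eps L (K + n)) ^ γ = (L : ℝ) ^ (-(γ * (K + 1 : ℕ))) := by
    rw [slice_rpow_eq L hL0 (n - 1) (K + n) γ]
    congr 1
    rw [Nat.cast_sub hn]
    push_cast
    ring
  -- termwise the majorant graph
  have hterm : ∀ j' : Fin m → Fin (K + n),
      (if ∃ ℓ, ((j' ℓ : ℕ)) < n then
        |graphValLS ((((L : ℝ) ^ (K + n))⁻¹) ^ (d + 1)) src tgt
          (fun ℓ (x' y' : Tor (fine (L ^ (K + n)) M)) =>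
            sliceLine (kingSliceKernels L (K + n) eM M hM (one_le_add_of_one_le hK n) a msq) (j' ℓ) (κ ℓ) x' y') vtx u'| else 0)
      ≤ (if ∃ ℓ, ((j' ℓ : ℕ)) < n then
        graphValLS ((((L : ℝ) ^ (K + n))⁻¹) ^ (d + 1)) src tgt
          (fun ℓ => (fun (ℓ : Fin m) (c : Fin (K + n)) (x' y' : Tor (fine (L ^ (K + n)) M)) =>
            |sliceLine (kingSliceKernels L (K + n) eM M hM (one_le_add_of_one_le hK n) a msq) c (κ ℓ) x' y'|) ℓ (j' ℓ))
          vtx (fun υ x' => |u' υ x'|) else 0) := by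
    intro j'
    split_ifs
    · have h := abs_graphValLS_le ((((L : ℝ) ^ (K + n))⁻¹) ^ (d + 1)) src tgt
        (fun ℓ (x' y' : Tor (fine (L ^ (K + n)) M)) =>
          sliceLine (kingSliceKernels L (K + n) eM M hM (one_le_add_of_one_le hK n) a msq) (j' ℓ) (κ ℓ) x' y') vtx u'
      rw [abs_of_nonneg hw0] at h
      exact h
    · exact le_rfl
  refine (sum_le_sum fun j' _ => hterm j').trans ?_
  rw [← hθ]
  exact sum_graphValLS_slices_lt_le_R L hL (by omega : 1 ≤ K + n) vtx hw0
    (fun (ℓ : Fin m) (c : Fin (K + n)) (x' y' : Tor (fine (L ^ (K + n)) M)) =>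
      |sliceLine (kingSliceKernels L (K + n) eM M hM (one_le_add_of_one_le hK n) a msq) c (κ ℓ) x' y'|)
    (fun ℓ c x y => abs_nonneg _) hC₁0 hC₂0 (((d + 1 : ℕ) : ℝ)) (fun ℓ => lineExp (d + 1) (κ ℓ))
    (fun ℓ c x y => (abs_sliceLine_le_sup L (one_le_add_of_one_le hK n) M hM hC hδ₀.le h37' (by have := c.isLt; omega) (κ ℓ) x y).trans
      (mul_le_mul_of_nonneg_right hC₁ (hs0 c _)))
    (fun ℓ c y => (lineSum_sliceLine_le_row L hL1 (one_le_add_of_one_le hK n) M hM hC hδ₀ h37' (by have := c.isLt; omega) (κ ℓ) y).trans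
      (mul_le_mul_of_nonneg_right (mul_le_mul hC₁ hC₂ (c368_pos d hδ₀).le hC₁0) (hs0 c _)))
    (fun ℓ c y => (lineSum_sliceLine_le_col L hL1 (one_le_add_of_one_le hK n) M hM hC hδ₀ h37' (by have := c.isLt; omega) (κ ℓ) y).trans
      (mul_le_mul_of_nonneg_right (mul_le_mul hC₁ hC₂ (c368_pos d hδ₀).le hC₁0) (hs0 c _)))
    (fun υ x' => |u' υ x'|) (fun υ x' => abs_nonneg _) υ₀ hυ₀ hΓ qq hu' cert hγ hn hpos

end PartAR

/-! ## §3 The replacement step's majorant graphs with one renumbering per ordering -/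

section PartBR

/-- ★★ **THE MAJORANT GRAPHS OF THE REPLACEMENT STEP, SUMMED OVER ALL ASSIGNMENTS, RELABELLED CERTIFICATES** (part Γ-e's, on `ForestCertR`): with (3.63)∕(3.73)-type profiles `profileAt C δ₀ c (e′_ℓ)` on the lines
(ANY real exponents `e′` — the size exponents `lineExp κ`, or those with one line lowered by `γ`), a root-placed `L¹` one-vertex majorant (`≤ Γ`) and sups `qq_υ`
elsewhere, and `PosDegrees` of the order lists of `e′` along every ordering: `Σ_j 𝔼(H(j)) ≤ Γ·C₁^m·C₂^{#vertices−1}·(Σ_π degConst L (orderList … e′ π …))·Π qq` —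
part Γ-b `sum_graphValLS_slices_le` with part Γ-d's profile letters (`C ≤ C₁`, `c368 ≤ C₂`). [cite: King1986, pp.664–665 (proof of Prop. 3.6), (3.63) p.663, (3.68) p.664] -/
theorem sum_graphValLS_profileAt_le_R (hL : 2 ≤ L) {K : ℕ} (hK : 1 ≤ K) (Mv : Fin (d + 1) → ℕ) [∀ μ, NeZero (Mv μ)]
    {C δ₀ C₁ C₂ : ℝ} (hC : 0 ≤ C) (hδ₀ : 0 < δ₀) (hC₁ : C ≤ C₁) (hC₂ : c368 d δ₀ ≤ C₂)
    {nn m : ℕ} {src tgt : Fin m → Fin (nn + 1)} {Υ : Type*} [Fintype Υ] [DecidableEq Υ] (vtx : Υ → Fin (nn + 1)) (e' : Fin m → ℝ)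
    (p : Υ → Tor (fine (L ^ K) Mv) → ℝ) (hp0 : ∀ υ x, 0 ≤ p υ x) (υ₀ : Υ) (hυ₀ : vtx υ₀ = 0) {Γ : ℝ}
    (hΓ : ∑ x, (((L : ℝ) ^ K)⁻¹) ^ (d + 1) * p υ₀ x ≤ Γ) (qq : Υ → ℝ) (hq : ∀ υ, υ ≠ υ₀ → ∀ x, p υ x ≤ qq υ)
    (cert : Equiv.Perm (Fin m) → ForestCertR nn src tgt) (hpos : ∀ π, PosDegrees (orderList ((d + 1 : ℕ) : ℝ) e' π (cert π).F)) :
    ∑ j : Fin m → Fin K, graphValLS ((((L : ℝ) ^ K)⁻¹) ^ (d + 1)) src tgt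
        (fun ℓ (x y : Tor (fine (L ^ K) Mv)) => profileAt L K Mv C δ₀ (j ℓ) (e' ℓ) x y) vtx p
      ≤ Γ * (C₁ ^ m * C₂ ^ nn * (∑ π : Equiv.Perm (Fin m), degConst L (orderList ((d + 1 : ℕ) : ℝ) e' π (cert π).F)) * ∏ υ ∈ univ.erase υ₀, qq υ) := by
  have hL1 : 1 ≤ L := by omega
  have hL0 : (0 : ℝ) < L := by exact_mod_cast (show 0 < L by omega)
  have hw0 : (0 : ℝ) ≤ (((L : ℝ) ^ K)⁻¹) ^ (d + 1) := by positivity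
  haveI : Nonempty (Tor (fine (L ^ K) Mv)) := ⟨fun _ => 0⟩
  have hC₁0 : 0 ≤ C₁ := hC.trans hC₁
  have hC₂0 : 0 ≤ C₂ := (c368_pos d hδ₀).le.trans hC₂
  have hs0 : ∀ (c : Fin K) (ex : ℝ), 0 ≤ ((L : ℝ) ^ ((c : ℕ)) * eps L K) ^ ex := fun c ex => Real.rpow_nonneg (by unfold eps; positivity) _
  exact sum_graphValLS_slices_le_R L hL hK vtx hw0
    (fun (ℓ : Fin m) (c : Fin K) (x y : Tor (fine (L ^ K) Mv)) => profileAt L K Mv C δ₀ c (e' ℓ) x y)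
    (fun ℓ c x y => profileAt_nonneg L Mv hC δ₀ _ _ x y) hC₁0 hC₂0 (((d + 1 : ℕ) : ℝ)) e'
    (fun ℓ c x y => (profileAt_le_sup L Mv hC hδ₀.le _ _ x y).trans (mul_le_mul_of_nonneg_right hC₁ (hs0 c _)))
    (fun ℓ c y => (lineSum_profileAt_row L hL1 Mv hC hδ₀ _ _ y).trans
      (mul_le_mul_of_nonneg_right (mul_le_mul hC₁ hC₂ (c368_pos d hδ₀).le hC₁0) (hs0 c _)))
    (fun ℓ c y => (lineSum_profileAt_col L hL1 Mv hC hδ₀ _ _ y).trans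
      (mul_le_mul_of_nonneg_right (mul_le_mul hC₁ hC₂ (c368_pos d hδ₀).le hC₁0) (hs0 c _)))
    p hp0 υ₀ hυ₀ hΓ qq hq cert hpos

end PartBR

end Summit.QuantumFields.YangMills.BalabanUVNodes.N15KingModelRung.Curved

end
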